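import Literature.AlgebraicGeometry.HyperbolicPolynomials.HyperbolicityConeComponent
import Literature.GroupTheory.ArithmeticGroups.PositiveDefiniteConeProperAction
import HarnessLib

/-!
# The determinant of a definite symmetric pencil is hyperbolic; its cone is the positive definite slice

Topic `Literature/AlgebraicGeometry/HyperbolicPolynomials`. The basic example behind "semidefinite
programming is hyperbolic programming" (Güler 1997, §2; Renegar 2006, §1) and the statement of the
generalised Lax conjecture, as printed by Borcea–Brändén–Liggett (J. Amer. Math. Soc. 22 (2009), §4.1,
examples after Prop. 4.4):

> (IV) Let `A_1, …, A_m` be symmetric `n × n` matrices and let `e = (e_1, …, e_m) ∈ ℝ^m` be such that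
> `e_1 A_1 + ⋯ + e_m A_m` is positive definite. Then the polynomial `p(z_1, …, z_m) = det(Σ_{j=1}^m z_j A_j)`
> is hyperbolic with respect to `e` and the hyperbolicity cone is given by
> `C_e(p) = {x ∈ ℝ^m : Σ_j x_j A_j is positive definite}`.

(Example (III), `det` of the generic symmetric matrix with respect to the identity, is the case of the
basis `E_{ii}`, `E_{ij} + E_{ji}`.)

## Main results (namespace `Literature.AlgebraicGeometry.HyperbolicPolynomials`)

* `detPencil A = det(Σ_j X_j A_j) ∈ R[X_j : j ∈ ι]` (definition with body, any commutative ring), with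
  `eval_detPencil` (`p(w) = det(Σ w_j A_j)`), `map_detPencil` (change of scalars) and
  `isHomogeneous_detPencil` (a form of degree `n`).
* `isHyperbolic_detPencil` — **`p` is hyperbolic w.r.t. `e`** when the `A_j` are symmetric and
  `Σ e_j A_j ≻ 0`. Proof: if `det(A(x) + z B) = 0` (`A(x) = Σ x_j A_j`, `B = Σ e_j A_j`, `z ∈ ℂ`) pick a
  complex kernel vector `v ≠ 0`; then `v* A(x) v + z · v* B v = 0` with `v* A(x) v`, `v* B v` real and
  `v* B v > 0`, so `z` is real.
* `mem_openHyperbolicityCone_detPencil_of_posDef` (`A(x) ≻ 0 ⇒ x ∈ C_e(p)`, as `A(x) + tB ≻ 0` for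
  `t ≥ 0`), `posDef_of_mem_openHyperbolicityCone_detPencil` (the converse, by connectedness: `C_e(p)` is
  convex, hence connected, contains `e`, and inside `{det ≠ 0}` the positive definite locus is both open
  and closed — a positive semidefinite matrix with nonzero determinant is definite), and
  **`openHyperbolicityCone_detPencil`**: `C_e(p) = {x : Σ x_j A_j ≻ 0}`; and the easy half of the
  closed cone, `mem_hyperbolicityCone_detPencil_of_posSemidef` (`A(x) ⪰ 0 ⇒ x ∈ Λ₊(p, e)`); §5
  **`hyperbolicityCone_detPencil`**: `Λ₊(p, e) = {x : Σ x_j A_j ⪰ 0}` (the closure of the open cone is contained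
  in the closed positive semidefinite locus).

## References

* [BorceaBrandenLiggett2007] J. Borcea, P. Brändén, T. M. Liggett, *Negative dependence and the geometry
  of polynomials*, J. Amer. Math. Soc. 22 (2009) 521–567 (arXiv:0707.2340): §4.1, examples (III), (IV)
  after Prop. 4.4 (PDF p. 15).
* [Guler1997] O. Güler, *Hyperbolic polynomials and interior point methods for convex programming*, Math.
  Oper. Res. 22 (1997) 350–377: §2, the examples `det` on symmetric / Hermitian matrices.
* [Renegar2006] J. Renegar, *Hyperbolic programs, and their derivative relaxations*, Found. Comput.
  Math. 6 (2006) 59–79: §1–§2 ("In SDP, where `p(x) = det(x)` … `Λ₊₊ = S^{n×n}_{++}`").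
-/

noncomputable section

open MvPolynomial Matrix
open _root_.Topology

namespace Literature.AlgebraicGeometry.HyperbolicPolynomials

variable {ι : Type*} [Fintype ι] {n : Type*} [Fintype n] [DecidableEq n]

/-! ## §1 The determinantal polynomial of a linear matrix pencil -/

section Def

variable {R : Type*} [CommRing R]

/-- **The determinant of the linear pencil** `Σ_j z_j A_j`: the polynomial
`p(z) = det(Σ_{j} z_j A_j) ∈ R[z_j : j ∈ ι]` of square matrices `A_j` over a commutative ring.
[cite: BorceaBrandenLiggett2007, §4.1 example (IV)] -/
def detPencil (A : ι → Matrix n n R) : MvPolynomial ι R :=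
  (∑ j, (X j : MvPolynomial ι R) • (A j).map C).det

/-- `detPencil` unfolded. [cite: BorceaBrandenLiggett2007, §4.1 example (IV)] -/
theorem detPencil_def (A : ι → Matrix n n R) :
    detPencil A = (∑ j, (X j : MvPolynomial ι R) • (A j).map C).det := rfl

/-- **Evaluation**: `p(w) = det(Σ_j w_j A_j)`. [cite: BorceaBrandenLiggett2007, §4.1 example (IV)] -/
theorem eval_detPencil (A : ι → Matrix n n R) (w : ι → R) :
    eval w (detPencil A) = (∑ j, w j • A j).det := by
  rw [detPencil, RingHom.map_det, RingHom.mapMatrix_apply]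
  congr 1
  ext a b
  simp [Matrix.sum_apply, Matrix.smul_apply]

/-- Change of scalars: `φ(p_A) = p_{φ(A)}` (used with `ℝ → ℂ`: the complex zeros of `p` are those of the
complexified pencil). [cite: BorceaBrandenLiggett2007, §4.1 example (IV)] -/
theorem map_detPencil {S : Type*} [CommRing S] (φ : R →+* S) (A : ι → Matrix n n R) :
    map φ (detPencil A) = detPencil fun j => (A j).map φ := by
  rw [detPencil, detPencil, RingHom.map_det, RingHom.mapMatrix_apply]
  congr 1
  ext a b
  simp [Matrix.sum_apply, Matrix.smul_apply, map_X, map_C]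

/-- `p_A` is a form of degree `n` (the size of the matrices). [cite: Guler1997, §2] -/
theorem isHomogeneous_detPencil (A : ι → Matrix n n R) :
    (detPencil A).IsHomogeneous (Fintype.card n) := by
  rw [detPencil, Matrix.det_apply]
  refine IsHomogeneous.sum _ _ _ fun τ _ => ?_
  have hprod : (∏ i, (∑ j, (X j : MvPolynomial ι R) • ((A j).map C : Matrix n n (MvPolynomial ι R)))
      (τ i) i).IsHomogeneous (Fintype.card n) := by
    have h := IsHomogeneous.prod Finset.univ
      (fun i => (∑ j, (X j : MvPolynomial ι R) • ((A j).map C : Matrix n n (MvPolynomial ι R))) (τ i) i)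
      (fun _ => 1) fun i _ => by
        simp only [Matrix.sum_apply, Matrix.smul_apply, Matrix.map_apply, smul_eq_mul]
        exact IsHomogeneous.sum _ _ _ fun j _ => by
          simpa using (isHomogeneous_X R j).mul (isHomogeneous_C ι (A j (τ i) i))
    simpa [Finset.sum_const, Finset.card_univ] using h
  rcases Int.units_eq_one_or (Equiv.Perm.sign τ) with hs | hs <;> rw [hs]
  · rw [one_smul]; exact hprod
  · rw [Units.neg_smul, one_smul]; exact hprod.neg

end Def

/-! ## §2 Real symmetric pencils: complexification and quadratic forms -/

section Real

variable {A : ι → Matrix n n ℝ} {e : ι → ℝ}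

omit [Fintype n] [DecidableEq n] in
/-- The pencil at a real point, with a second point split off along `z ∈ ℂ`:
`Σ_j (x_j + z e_j) A_j = A(x) + z A(e)` after complexification. [folklore] -/
private theorem pencil_complex_split (A : ι → Matrix n n ℝ) (x e : ι → ℝ) (z : ℂ) :
    (∑ j, ((x j : ℂ) + z * (e j : ℂ)) • (A j).map (algebraMap ℝ ℂ)) =
      (∑ j, x j • A j).map (algebraMap ℝ ℂ) + z • (∑ j, e j • A j).map (algebraMap ℝ ℂ) := by
  ext a b
  simp only [Matrix.sum_apply, Matrix.smul_apply, Matrix.map_apply, Matrix.add_apply, smul_eq_mul,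
    Complex.coe_algebraMap, Complex.ofReal_sum, Complex.ofReal_mul, Finset.mul_sum, add_mul,
    Finset.sum_add_distrib]
  congr 1
  exact Finset.sum_congr rfl fun j _ => by ring

omit [Fintype n] [DecidableEq n] in
/-- A real linear combination of symmetric matrices is symmetric. [folklore] -/
private theorem isSymm_pencil (hA : ∀ j, (A j).IsSymm) (w : ι → ℝ) : (∑ j, w j • A j).IsSymm := by
  unfold Matrix.IsSymm
  rw [Matrix.transpose_sum]
  exact Finset.sum_congr rfl fun j _ => by rw [Matrix.transpose_smul, (hA j).eq]

omit [Fintype n] [DecidableEq n] in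
/-- The complexification of a real symmetric matrix is Hermitian. [folklore] -/
private theorem isHermitian_map_of_isSymm {M : Matrix n n ℝ} (hM : M.IsSymm) :
    (M.map (algebraMap ℝ ℂ)).IsHermitian := by
  have h : M.IsHermitian := by simpa using hM
  exact h.map _ fun r => by simp

omit [DecidableEq n] in
/-- For a real positive definite `S` and a nonzero complex vector `v`, `Re (v* S v) > 0`
(`Re (v* S v) = aᵀ S a + bᵀ S b` for `v = a + ib`). Cf. the tree's `posDef_map_ofReal_iff`
(Siegel upper half space file), restated here to keep the imports elementary. [folklore] -/
private theorem re_star_dotProduct_map_mulVec_pos {S : Matrix n n ℝ} (hS : S.PosDef) {v : n → ℂ}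
    (hv : v ≠ 0) : 0 < (star v ⬝ᵥ (S.map (algebraMap ℝ ℂ)) *ᵥ v).re := by
  set a : n → ℝ := fun j => (v j).re with ha
  set b : n → ℝ := fun j => (v j).im with hb
  have hre : (star v ⬝ᵥ (S.map (algebraMap ℝ ℂ)) *ᵥ v).re = a ⬝ᵥ S *ᵥ a + b ⬝ᵥ S *ᵥ b := by
    simp only [dotProduct, mulVec, Matrix.map_apply, Pi.star_apply, Finset.mul_sum, Complex.re_sum,
      ← Finset.sum_add_distrib]
    refine Finset.sum_congr rfl fun i _ => Finset.sum_congr rfl fun k _ => ?_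
    simp only [Complex.mul_re, Complex.mul_im, Complex.star_def, Complex.conj_re, Complex.conj_im,
      Complex.coe_algebraMap, Complex.ofReal_re, Complex.ofReal_im, ha, hb]
    ring
  rw [hre]
  have hnn : ∀ w : n → ℝ, 0 ≤ w ⬝ᵥ S *ᵥ w := fun w => by
    simpa using hS.posSemidef.dotProduct_mulVec_nonneg w
  have hpos : ∀ w : n → ℝ, w ≠ 0 → 0 < w ⬝ᵥ S *ᵥ w := fun w hw => by
    simpa using hS.dotProduct_mulVec_pos hw
  by_cases ha0 : a = 0
  · have hb0 : b ≠ 0 := by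
      intro hb0
      apply hv
      funext j
      apply Complex.ext
      · simpa [ha] using congr_fun ha0 j
      · simpa [hb] using congr_fun hb0 j
    exact add_pos_of_nonneg_of_pos (hnn a) (hpos b hb0)
  · exact add_pos_of_pos_of_nonneg (hpos a ha0) (hnn b)

/-- **`p(x) > 0` at positive definite points.** [cite: Renegar2006, §1] -/
theorem eval_detPencil_pos {x : ι → ℝ} (hx : (∑ j, x j • A j).PosDef) : 0 < eval x (detPencil A) := by
  rw [eval_detPencil]
  exact hx.det_pos

/-! ## §3 Hyperbolicity -/

/-- **Borcea–Brändén–Liggett §4.1 (IV), first half: the determinant of a definite symmetric pencil is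
hyperbolic.** If `A_j` are real symmetric and `Σ e_j A_j` is positive definite, then
`p(z) = det(Σ z_j A_j)` is hyperbolic with respect to `e`. [cite: BorceaBrandenLiggett2007, §4.1 example
(IV)] [cite: Guler1997, §2] -/
theorem isHyperbolic_detPencil (hA : ∀ j, (A j).IsSymm) (he : (∑ j, e j • A j).PosDef) :
    IsHyperbolic (detPencil A) e := by
  refine ⟨(eval_detPencil_pos he).ne', fun x z hz => ?_⟩
  rw [map_detPencil, eval_detPencil, pencil_complex_split] at hz
  obtain ⟨v, hv0, hv⟩ := Matrix.exists_mulVec_eq_zero_iff.2 hz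
  have h1 : star v ⬝ᵥ (((∑ j, x j • A j).map (algebraMap ℝ ℂ) +
      z • (∑ j, e j • A j).map (algebraMap ℝ ℂ)) *ᵥ v) = 0 := by
    rw [hv, dotProduct_zero]
  rw [add_mulVec, smul_mulVec, dotProduct_add, dotProduct_smul, smul_eq_mul] at h1
  have hα := (isHermitian_map_of_isSymm (isSymm_pencil hA x)).im_star_dotProduct_mulVec_self v
  have hβ := (isHermitian_map_of_isSymm (isSymm_pencil hA e)).im_star_dotProduct_mulVec_self v
  rw [RCLike.im_to_complex] at hα hβ
  have hβre := re_star_dotProduct_map_mulVec_pos he hv0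
  have him := congrArg Complex.im h1
  rw [Complex.add_im, Complex.mul_im, hα, hβ, Complex.zero_im, mul_zero, zero_add, zero_add] at him
  exact (mul_eq_zero.1 him).resolve_right hβre.ne'

/-! ## §4 The hyperbolicity cone is the positive definite slice of the pencil -/

omit [Fintype n] [DecidableEq n] in
/-- The pencil is additive and homogeneous in the parameter: `A(x + τe) = A(x) + τ A(e)`. [folklore] -/
private theorem pencil_add_smul (A : ι → Matrix n n ℝ) (x e : ι → ℝ) (τ : ℝ) :
    (∑ j, (x + τ • e) j • A j) = (∑ j, x j • A j) + τ • ∑ j, e j • A j := by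
  simp only [Pi.add_apply, Pi.smul_apply, smul_eq_mul, add_smul, Finset.sum_add_distrib,
    Finset.smul_sum, smul_smul]

/-- **`{A(x) ≻ 0} ⊆ C_e(p)`**: if `Σ e_j A_j ⪰ 0` and `Σ x_j A_j ≻ 0` then `A(x) + τ A(e) ≻ 0` for all
`τ ≥ 0`, so `p(x + τe) > 0`. [cite: BorceaBrandenLiggett2007, §4.1 example (IV)] -/
theorem mem_openHyperbolicityCone_detPencil_of_posDef {x : ι → ℝ} (he : (∑ j, e j • A j).PosSemidef)
    (hx : (∑ j, x j • A j).PosDef) : x ∈ openHyperbolicityCone (detPencil A) e := by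
  intro τ hτ
  rw [eval_detPencil, pencil_add_smul]
  exact (hx.add_posSemidef (he.smul hτ)).det_pos.ne'

omit [DecidableEq n] in
/-- On symmetric matrices, positive definiteness is the positivity of the quadratic form.
[folklore] -/
private theorem posDef_iff_forall_pos {M : Matrix n n ℝ} (hM : M.IsSymm) :
    M.PosDef ↔ ∀ v : n → ℝ, v ≠ 0 → 0 < v ⬝ᵥ M *ᵥ v := by
  rw [Matrix.posDef_iff_dotProduct_mulVec]
  have h : M.IsHermitian := by simpa using hM
  simp only [h, true_and, star_trivial]

omit [DecidableEq n] in
/-- The positive definite locus of a symmetric pencil is open in the parameter. [folklore] -/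
private theorem isOpen_setOf_posDef_pencil (hA : ∀ j, (A j).IsSymm) :
    IsOpen {y : ι → ℝ | (∑ j, y j • A j).PosDef} := by
  have hcont : Continuous fun y : ι → ℝ => ∑ j, y j • A j :=
    continuous_finsetSum _ fun j _ => (continuous_apply j).smul continuous_const
  have hset : {y : ι → ℝ | (∑ j, y j • A j).PosDef} =
      (fun y : ι → ℝ => ∑ j, y j • A j) ⁻¹' {S : Matrix n n ℝ | ∀ v : n → ℝ, v ≠ 0 → 0 < v ⬝ᵥ S *ᵥ v} := by
    ext y
    simp only [Set.mem_setOf_eq, Set.mem_preimage, posDef_iff_forall_pos (isSymm_pencil hA y)]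
  rw [hset]
  exact (Literature.GroupTheory.ArithmeticGroups.isOpen_setOf_dotProduct_mulVec_pos).preimage hcont

omit [DecidableEq n] in
/-- The positive semidefinite locus of a symmetric pencil is closed in the parameter. [folklore] -/
private theorem isClosed_setOf_posSemidef_pencil (hA : ∀ j, (A j).IsSymm) :
    IsClosed {y : ι → ℝ | (∑ j, y j • A j).PosSemidef} := by
  have hset : {y : ι → ℝ | (∑ j, y j • A j).PosSemidef} =
      ⋂ v : n → ℝ, {y : ι → ℝ | 0 ≤ v ⬝ᵥ (∑ j, y j • A j) *ᵥ v} := by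
    ext y
    have h : (∑ j, y j • A j).IsHermitian := by simpa using isSymm_pencil hA y
    simp only [Set.mem_setOf_eq, Set.mem_iInter, Matrix.posSemidef_iff_dotProduct_mulVec, h, true_and,
      star_trivial]
  rw [hset]
  refine isClosed_iInter fun v => isClosed_le continuous_const ?_
  have hcont : Continuous fun y : ι → ℝ => ∑ j, y j • A j :=
    continuous_finsetSum _ fun j _ => (continuous_apply j).smul continuous_const
  exact continuous_const.dotProduct (hcont.matrix_mulVec continuous_const)

/-- **`C_e(p) ⊆ {A(x) ≻ 0}`**: every point of the open hyperbolicity cone of `p = det(Σ z_j A_j)`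
(`A_j` symmetric, `Σ e_j A_j ≻ 0`) gives a positive definite matrix. Proof by connectedness
(`HyperbolicityConeComponent.lean`): `C_e(p)` is convex and contains `e`; on it `det A(·) ≠ 0`, so the
positive definite locus (open) coincides there with the positive semidefinite locus (closed), and a clopen
subset of a connected set containing `e` is everything. [cite: BorceaBrandenLiggett2007, §4.1 example
(IV)] -/
theorem posDef_of_mem_openHyperbolicityCone_detPencil (hA : ∀ j, (A j).IsSymm)
    (he : (∑ j, e j • A j).PosDef) {x : ι → ℝ} (hx : x ∈ openHyperbolicityCone (detPencil A) e) :
    (∑ j, x j • A j).PosDef := by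
  have hhyp := isHyperbolic_detPencil hA he
  have hhom := isHomogeneous_detPencil A
  have hsub : openHyperbolicityCone (detPencil A) e ⊆ {y : ι → ℝ | (∑ j, y j • A j).PosDef} := by
    refine (convex_openHyperbolicityCone hhom hhyp).isPreconnected.subset_left_of_subset_union
      (isOpen_setOf_posDef_pencil hA) (isClosed_setOf_posSemidef_pencil hA).isOpen_compl ?_ ?_
      ⟨e, self_mem_openHyperbolicityCone hhom hhyp.eval_ne_zero, he⟩
    · exact Set.disjoint_left.2 fun y (hy : (∑ j, y j • A j).PosDef) hy' => hy' hy.posSemidef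
    · intro y hy
      by_cases hpsd : (∑ j, y j • A j).PosSemidef
      · left
        refine hpsd.posDef_iff_det_ne_zero.2 ?_
        rw [← eval_detPencil]
        exact eval_ne_zero_of_mem_openHyperbolicityCone hy
      · right
        exact hpsd
  exact hsub hx

/-- **Borcea–Brändén–Liggett §4.1 (IV), second half: the hyperbolicity cone of `det(Σ z_j A_j)` is
`{x : Σ x_j A_j ≻ 0}`** (`A_j` symmetric, `Σ e_j A_j ≻ 0`; e.g. the cone of positive definite matrices for
`det` on symmetric matrices w.r.t. `I`). [cite: BorceaBrandenLiggett2007, §4.1 example (IV)]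
[cite: Renegar2006, §2] -/
theorem openHyperbolicityCone_detPencil (hA : ∀ j, (A j).IsSymm) (he : (∑ j, e j • A j).PosDef) :
    openHyperbolicityCone (detPencil A) e = {x : ι → ℝ | (∑ j, x j • A j).PosDef} :=
  Set.Subset.antisymm (fun _ hx => posDef_of_mem_openHyperbolicityCone_detPencil hA he hx)
    fun _ hx => mem_openHyperbolicityCone_detPencil_of_posDef he.posSemidef hx

/-- The closed cone: `Λ₊(p, e) = {x : Σ x_j A_j ⪰ 0}` would need the closure of the definite slice; here
the easy inclusion `{A(x) ⪰ 0} ⊆ Λ₊(p, e)` (`A(x) + τ A(e) ≻ 0` for `τ > 0`).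
[cite: Renegar2006, §2 (`Λ₊` is the closure of `Λ₊₊`)] -/
theorem mem_hyperbolicityCone_detPencil_of_posSemidef (he : (∑ j, e j • A j).PosDef) {x : ι → ℝ}
    (hx : (∑ j, x j • A j).PosSemidef) : x ∈ hyperbolicityCone (detPencil A) e := by
  intro τ hτ
  rw [eval_detPencil, pencil_add_smul]
  exact (Matrix.PosDef.posSemidef_add hx (he.smul hτ)).det_pos.ne'

/-! ## §5 The closed hyperbolicity cone is the positive semidefinite slice -/

/-- **`Λ₊(p, e) ⊆ {A(x) ⪰ 0}`**: the closed cone is the closure of the open cone `{A(x) ≻ 0}` (Renegar: "`Λ₊`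
… is the closure of `Λ₊₊`"), and the positive semidefinite locus of the pencil is closed.
[cite: Renegar2006, §2 (`Λ₊` is the closure of `Λ₊₊`)] [cite: BorceaBrandenLiggett2007, §4.1 example (IV)] -/
theorem posSemidef_of_mem_hyperbolicityCone_detPencil (hA : ∀ j, (A j).IsSymm)
    (he : (∑ j, e j • A j).PosDef) {x : ι → ℝ} (hx : x ∈ hyperbolicityCone (detPencil A) e) :
    (∑ j, x j • A j).PosSemidef := by
  have hhyp := isHyperbolic_detPencil hA he
  have hsub : hyperbolicityCone (detPencil A) e ⊆ {y : ι → ℝ | (∑ j, y j • A j).PosSemidef} := by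
    rw [hyperbolicityCone_eq_closure (isHomogeneous_detPencil A) hhyp, openHyperbolicityCone_detPencil hA he]
    exact closure_minimal (fun y (hy : (∑ j, y j • A j).PosDef) => hy.posSemidef)
      (isClosed_setOf_posSemidef_pencil hA)
  exact hsub hx

/-- **The closed hyperbolicity cone of `det(Σ z_j A_j)` is `{x : Σ x_j A_j ⪰ 0}`** (`A_j` symmetric,
`Σ e_j A_j ≻ 0`; e.g. `Λ₊ = ` the positive semidefinite cone for `det` on symmetric matrices, Renegar:
"`Λ₊ := {x : λ_min(x) ≥ 0}`"). [cite: Renegar2006, §2] [cite: BorceaBrandenLiggett2007, §4.1 example (IV)] -/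
theorem hyperbolicityCone_detPencil (hA : ∀ j, (A j).IsSymm) (he : (∑ j, e j • A j).PosDef) :
    hyperbolicityCone (detPencil A) e = {x : ι → ℝ | (∑ j, x j • A j).PosSemidef} :=
  Set.Subset.antisymm (fun _ hx => posSemidef_of_mem_hyperbolicityCone_detPencil hA he hx)
    fun _ hx => mem_hyperbolicityCone_detPencil_of_posSemidef he hx

end Real

end Literature.AlgebraicGeometry.HyperbolicPolynomials
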